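import Literature.IUT.HodgeArakelov.PlusMinusTowerStableCurveBridge
import HarnessLib

/-!
# [IUTchII] Def 2.3 (ii): the interface `CuspidalInertiaData W` is inhabited — NV-L6 row «CuspidalInertiaData»

S. Mochizuki, *Inter-universal Teichmüller Theory II*, kurims manuscript (Dec. 2020), §2, Def 2.3 (ii) pp. 67–68
(«the cuspidal inertia groups of `Π_⊇` may be reconstructed group-theoretically … [AbsTopI], Lemma 4.5 …; the
cuspidal inertia groups of `Π_⊆` may be obtained as the intersections with `Π_⊆` of those cuspidal inertia groups of
`Π_⊇` …») [cite: Mochizuki2012, II Def 2.3 (ii) pp.67–68]. abc-iut cell, L6 BY-NAME queue, §F v1.18p «NV-L6 WAVE»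
(abc-iut-L6-lead 2026-08-26T02:59:23Z; census HOME/staging/w5/w5-d114/INHABITATION-CENSUS-L6-v3.md §A: 0 producers),
seat abc-iut-w5-d028. PROOF-ONLY: every witness is built INSIDE a theorem term; no `def`, no `instance`, no
`structure`.

abc-iut-L6-t1's `CuspidalInertiaData W` (`LabelClassesOfCusps.lean`) is the INTERFACE «which subgroups `I ≤ Π` of the
six groups `Π ⊆ Π̂^cor_v` are cuspidal inertia groups» — a predicate `IsCuspidalInertia` with the single law `I ≤ Π`.
Two witnesses, honestly labelled:

* `CuspidalInertiaData.nonempty_degenerate` — for EVERY `±`-tower `W`: the DEGENERATE predicate «every subgroup of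
  `Π` is a cuspidal inertia group of `Π`» satisfies the one law. (Shows only that the interface is consistent over
  any tower; NOT print's notion.)
* `CuspidalInertiaData.exists_model_of_agreementIso` — GENUINE RELATIVE TO abc-iut-L5-t1's [IUTchI] §2 cusp data:
  for every tower `W`, every `D : StableCurveTemperedData` ([IUTchI] §2: `Π^tp_X ↪ Π̂_X`, the cusps `x` and their
  inertia groups `I_x ⊆ Δ^tp_X`) and every group isomorphism `eHat : Π̂^±_v ⥲ Π̂_X` (the `eHat` datum of
  abc-iut-L6-lead's `StableCurveAgreement`), there is a `C : CuspidalInertiaData W` whose cuspidal inertia groups of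
  `Π^±_v` are EXACTLY the `Π^tp_X`-conjugates of the `I_x` read through `eHat` — i.e. `C` satisfies the `inertia_iff`
  clause of `StableCurveAgreement W C D` — and whose cuspidal inertia groups at any level `Π` are the intersections
  `I₀ ∩ Π` of those (print's recipe «intersections with `Π_⊆`», Def 2.3 (ii), for the levels `Π ⊆ Π^±_v`; at the
  hatted / `cor` levels this is a definitional extension, NOT the [AbsTopI] Lem 4.5 notion — said here once).

What is NOT witnessed here (NV-BLOCKED upstream, recorded): an ABSOLUTE producer of the tower `W : PlusMinusTower T`
itself (NV-L6 row «PlusMinusTower», another seat) — every statement below is quantified over `W`. Nothing of the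
series is asserted; consistency ≠ endorsement; no side taken on [IUTchIII] Cor 3.12.
-/

namespace Literature.IUT.HodgeArakelov

open Literature.IUT.HodgeTheaters
open scoped Pointwise

universe u

variable {S : BadPlaceSetting.{u}} {P : TopGroup.{u}} {T : TemperedCoverings S P}

namespace CuspidalInertiaData

/-- **IUTchII:Def2.3(ii)** (kurims pp.67–68) DEGENERATE witness: over ANY `±`-tower `W` the interface
`CuspidalInertiaData W` is inhabited by the predicate «`I` is a cuspidal inertia group of `Π` iff `I ≤ Π`» (every
subgroup counts). degenerate: NOT print's [AbsTopI] Lem 4.5 notion — consistency of the interface only.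
[cite: Mochizuki2012, II Def 2.3 (ii) pp.67–68] -/
theorem nonempty_degenerate (W : PlusMinusTower T) : Nonempty (CuspidalInertiaData W) :=
  ⟨{ IsCuspidalInertia := fun Q I => I ≤ Q
     le_of_isCuspidalInertia := fun h => h }⟩

/-- **IUTchII:Def2.3(ii)** (kurims pp.67–68) GENUINE witness RELATIVE TO [IUTchI] §2 cusp data: for every tower `W`,
every `D : StableCurveTemperedData` (abc-iut-L5-t1) and every `eHat : Π̂^±_v ⥲ Π̂_X`, there is a
`CuspidalInertiaData W` whose cuspidal inertia groups OF `Π^±_v` are exactly the `Π^tp_X`-conjugates of the inertia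
groups `I_x` of the cusps of `X`, read in `Π̂^±_v` through `eHat` — the `inertia_iff` clause of
`PlusMinusTower.StableCurveAgreement` holds for it BY CONSTRUCTION — and whose cuspidal inertia groups of a general
level `Π` are the intersections `I₀ ⊓ Π` of those («obtained as the intersections with `Π_⊆`», Def 2.3 (ii)).
[cite: Mochizuki2012, II Def 2.3 (ii) pp.67–68] -/
theorem exists_model_of_agreementIso (W : PlusMinusTower T) (D : StableCurveTemperedData.{u})
    (eHat : W.pmHat ≃* D.PiHat) :
    ∃ C : CuspidalInertiaData W,
      (∀ I : Subgroup W.Corhat, C.IsCuspidalInertia W.piPM I ↔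
        I ≤ W.piPM ∧ ∃ (x : D.Cusp) (t : D.PiTp), (I.subgroupOf W.pmHat).map eHat.toMonoidHom =
          (MulAut.conj t • (D.inertiaTp x).map D.DeltaTp.subtype).map D.ιX) ∧
      (∀ (Q I : Subgroup W.Corhat), C.IsCuspidalInertia Q I ↔
        I ≤ Q ∧ ∃ I₀ : Subgroup W.Corhat, C.IsCuspidalInertia W.piPM I₀ ∧ I = I₀ ⊓ Q) := by
  -- the genuine notion at the level `Π^±_v`, transported through `eHat`
  let Gen : Subgroup W.Corhat → Prop := fun I₀ =>
    I₀ ≤ W.piPM ∧ ∃ (x : D.Cusp) (t : D.PiTp), (I₀.subgroupOf W.pmHat).map eHat.toMonoidHom =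
      (MulAut.conj t • (D.inertiaTp x).map D.DeltaTp.subtype).map D.ιX
  have hGen : ∀ I : Subgroup W.Corhat, (I ≤ W.piPM ∧ ∃ I₀, Gen I₀ ∧ I = I₀ ⊓ W.piPM) ↔ Gen I := by
    intro I
    constructor
    · rintro ⟨-, I₀, hI₀, rfl⟩
      have : I₀ ⊓ W.piPM = I₀ := inf_eq_left.mpr hI₀.1
      rw [this]
      exact hI₀
    · intro hI
      exact ⟨hI.1, I, hI, (inf_eq_left.mpr hI.1).symm⟩
  refine ⟨{ IsCuspidalInertia := fun Q I => I ≤ Q ∧ ∃ I₀, Gen I₀ ∧ I = I₀ ⊓ Q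
            le_of_isCuspidalInertia := fun h => h.1 }, fun I => hGen I, fun Q I => ?_⟩
  change (I ≤ Q ∧ ∃ I₀, Gen I₀ ∧ I = I₀ ⊓ Q) ↔ I ≤ Q ∧ ∃ I₀, (I₀ ≤ W.piPM ∧ ∃ I₁, Gen I₁ ∧ I₀ = I₁ ⊓ W.piPM) ∧ I = I₀ ⊓ Q
  simp only [hGen]

/-- **IUTchII:Def2.3(ii)** (kurims p.67) … in particular, for every tower, stable-curve datum and `eHat`, SOME
`CuspidalInertiaData W` satisfies the cuspidal-inertia clause `inertia_iff` of abc-iut-L6-lead's `StableCurveAgreement`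
(the other three clauses concern `W` and `eHat` only). [cite: Mochizuki2012, II Def 2.3 (i)(ii) p.67] -/
theorem exists_inertia_iff (W : PlusMinusTower T) (D : StableCurveTemperedData.{u}) (eHat : W.pmHat ≃* D.PiHat) :
    ∃ C : CuspidalInertiaData W, ∀ I : Subgroup W.Corhat, C.IsCuspidalInertia W.piPM I ↔
      I ≤ W.piPM ∧ ∃ (x : D.Cusp) (t : D.PiTp), (I.subgroupOf W.pmHat).map eHat.toMonoidHom =
        (MulAut.conj t • (D.inertiaTp x).map D.DeltaTp.subtype).map D.ιX :=
  let ⟨C, h, _⟩ := exists_model_of_agreementIso W D eHat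
  ⟨C, h⟩

end CuspidalInertiaData

end Literature.IUT.HodgeArakelov
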